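import Summits.CriticalPhenomena.PercolationContinuityZ3.Theses.PercNearOneGluing
import Literature.Probability.Percolation.PercolationProofs
import Literature.Probability.Percolation.ConditionalPositiveAssociationProofs
import Literature.Probability.Percolation.TwoClusterConditionalAssociationProofs

/-! TTRL-lite variant V1436 of stmt-CriticalPhenomena-4576

**Verdict: DISPROVED.**  V1436 drops the deadness condition `Disjoint W A` from the pocket sum of
the good-step inequality (`stub_goodStep` of the crux `PercNearOneGluing.AdditiveGluing`), i.e. it
penalises *every* value `W ∋ o` of the cluster `C(o)`, not only the dead pockets.  But a pocket
`W ∋ b` has `openConnIn Wᶜ (sel W) b = ∅` (the restricted connection needs `b ∈ Wᶜ`), so its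
penalty factor is `μ(univ) = 1` and the sum dominates `μ(C(o) ∋ b) = μ(o ↔ b)`, which the relay
hypothesis does not control.  Witness: `n = 2`, `o = 0`, `b = 1`, `A = {1}`, `w ≡ 1` (so that
`prodBernoulli w = δ_univ`), `t = 0`, `sel ≡ 1`: the relay hypothesis reads `1 - 0 ≤ μ(1 ↔ 1) = 1`,
while the pocket `W = univ` alone contributes `μ(C(0) = univ) · μ(∅ᶜ) = 1 · 1 = 1 > 0 = t`.
-/

namespace Summit.CriticalPhenomena.PercolationContinuityZ3.Theorems

open MeasureTheory Literature.Probability.LatticeModels Literature.Probability.Percolation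
open scoped Classical BigOperators

/-- **TTRL-lite variant V1436 (pocket sum over all `W ∋ o`, `Disjoint W A` dropped) of the good-step
inequality of stmt-CriticalPhenomena-4576 is false.**  Counterexample: `n = 2`, `o = 0`, `b = 1`,
`A = {1}`, `w ≡ 1`, `t = 0`, `sel ≡ 1`; then `prodBernoulli w` is the Dirac mass at the full
configuration, the relay hypothesis is `1 - 0 ≤ μ(1 ↔ 1) = 1`, and the pocket `W = univ ∋ b`
contributes `μ(C(0) = univ) · μ((openConnIn ∅ 1 1)ᶜ) = 1 · 1 = 1` to a left-hand side that should be
`≤ 0`. [this project] -/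
theorem cp4576_goodstep_var1436_false : ¬ (∀ (n : ℕ) (w : Sym2 (Fin n) → unitInterval) (A : Finset (Fin n)) (o b : Fin n), b ∈ A → o ∉ A → ∀ (t : ℝ) (sel : Finset (Fin n) → Fin n), (∀ W, sel W ∈ A) → (∀ a ∈ A, 1 - t ≤ (prodBernoulli w).real (openConn a b)) → (prodBernoulli w).real ((⋃ a ∈ A, openConn o a) ∩ (openConn o b)ᶜ) + ∑ W ∈ (Finset.univ : Finset (Finset (Fin n))).filter (fun W => o ∈ W), (prodBernoulli w).real {ω : BondConfig (Fin n) | openCluster ω o = (W : Set (Fin n))} * (prodBernoulli w).real (openConnIn ((W : Set (Fin n))ᶜ) (sel W) b)ᶜ ≤ t) := by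
  intro h
  -- the witness weighting: every pair of `Fin 2` is open with probability one
  set w : Sym2 (Fin 2) → unitInterval := fun _ => 1 with hw
  have hμ : prodBernoulli w = Measure.dirac (Set.univ : Set (Sym2 (Fin 2))) := by
    rw [hw, prodBernoulli_const, ProbabilityTheory.setBernoulli_one]
  have hA : (1 : Fin 2) ∈ ({1} : Finset (Fin 2)) := Finset.mem_singleton_self _
  have hoA : (0 : Fin 2) ∉ ({1} : Finset (Fin 2)) := by decide
  -- the relay hypothesis at level `t = 0`: `μ(1 ↔ 1) = 1`
  have hrel : ∀ a ∈ ({1} : Finset (Fin 2)), 1 - (0 : ℝ) ≤ (prodBernoulli w).real (openConn a 1) := by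
    intro a ha
    rw [Finset.mem_singleton.1 ha]
    have huniv : (openConn 1 1 : Set (BondConfig (Fin 2))) = Set.univ := by
      ext ω
      simp only [Set.mem_univ, iff_true]
      exact SimpleGraph.Reachable.refl _
    rw [huniv, probReal_univ]
    norm_num
  have key := h 2 w {1} 0 1 hA hoA 0 (fun _ => 1) (fun _ => hA) hrel
  beta_reduce at key
  -- the pocket `W = univ ∋ b` is penalised although it is not dead
  have hWmem : (Finset.univ : Finset (Fin 2)) ∈
      (Finset.univ : Finset (Finset (Fin 2))).filter (fun W => (0 : Fin 2) ∈ W) :=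
    Finset.mem_filter.2 ⟨Finset.mem_univ _, Finset.mem_univ _⟩
  -- under `δ_univ` the cluster of `0` is everything
  have hcl : (prodBernoulli w).real
      {ω : BondConfig (Fin 2) | openCluster ω 0 = ((Finset.univ : Finset (Fin 2)) : Set (Fin 2))} = 1 := by
    have hmem : (Set.univ : Set (Sym2 (Fin 2))) ∈
        {ω : BondConfig (Fin 2) | openCluster ω 0 = ((Finset.univ : Finset (Fin 2)) : Set (Fin 2))} := by
      simp only [Finset.coe_univ, Set.mem_setOf_eq]
      ext y
      simp only [Set.mem_univ, iff_true, openCluster, Set.mem_setOf_eq]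
      by_cases hy : y = 0
      · subst hy
        exact SimpleGraph.Reachable.refl _
      · refine SimpleGraph.Adj.reachable ?_
        rw [openGraph_adj]
        exact ⟨Set.mem_univ _, Ne.symm hy⟩
    rw [hμ, measureReal_def, Measure.dirac_apply_of_mem hmem, ENNReal.toReal_one]
  -- and the restricted connection `1 ↔ 1 in univᶜ = ∅` is impossible, so its complement is sure
  have hin : (prodBernoulli w).real
      (openConnIn (((Finset.univ : Finset (Fin 2)) : Set (Fin 2))ᶜ) (1 : Fin 2) 1)ᶜ = 1 := by
    have hempty : (openConnIn (((Finset.univ : Finset (Fin 2)) : Set (Fin 2))ᶜ) (1 : Fin 2) 1 :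
        Set (BondConfig (Fin 2))) = ∅ := by
      ext ω
      simp [openConnIn]
    rw [hempty, Set.compl_empty, probReal_univ]
  have hle := Finset.single_le_sum
    (s := (Finset.univ : Finset (Finset (Fin 2))).filter (fun W => (0 : Fin 2) ∈ W))
    (f := fun W : Finset (Fin 2) =>
      (prodBernoulli w).real {ω : BondConfig (Fin 2) | openCluster ω 0 = (W : Set (Fin 2))} *
        (prodBernoulli w).real (openConnIn ((W : Set (Fin 2))ᶜ) (1 : Fin 2) 1)ᶜ)
    (fun W _ => mul_nonneg measureReal_nonneg measureReal_nonneg) hWmem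
  rw [hcl, hin, one_mul] at hle
  have hnn : 0 ≤ (prodBernoulli w).real
      ((⋃ a ∈ ({1} : Finset (Fin 2)), openConn (0 : Fin 2) a) ∩ (openConn (0 : Fin 2) 1)ᶜ) :=
    measureReal_nonneg
  linarith

end Summit.CriticalPhenomena.PercolationContinuityZ3.Theorems
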